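import Summits.AtomisticToContinuum.BoseEinsteinCondensation.Theorems.BECCutLineWeakDisorderGroundStateRigidityStubLincombGroundState
import Summits.AtomisticToContinuum.BoseEinsteinCondensation.Theorems.BECCutLineWeakDisorderGroundStateRigidityStubClosedJensen
import HarnessLib

/-!
# Crux `GroundStateRigidity` (stmt-AtomisticToContinuum-9072), line `Sketch`:
# the registered stub `stub_kineticCauchy` (Stub 15c)

Supports (does not close) stmt-AtomisticToContinuum-9072; stub `stub_kineticCauchy` of line
`Sketch` (lead c3). **Near-optimal trial-state approximants of a measurable `Ψ` for an
INCREASING family of pair potentials `w m` are Cauchy in kinetic energy.** Write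
`Q(f) = ∫⁻ (|∇f|² + W₀|f|²)` for the raw quadratic form of the FIXED potential `w m₀` on `C¹`
functions (`W₀ = ∑_{i<j} w m₀ (|xᵢ - xⱼ|)`), where `m₀` is chosen with `S ≤ q̄_{w m₀}[Ψ] + δ`.

* Upper bound: for `m ≥ m₀`, `Q(Φₘ) ≤ energy (w m) Φₘ ≤ S + δ` eventually (monotone family).
* Lower bound on sums: `4 S ≤ Q(Φₘ + Φₘ') + 8δ` for all large `m, m'`. Otherwise along a sequence
  of violating pairs the normalised midpoints `(Φₘ + Φₘ')/‖Φₘ + Φₘ'‖₂` are trial states converging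
  to `Ψ` in `L²` (`‖(Φₘ + Φₘ')/2‖₂ → ‖Ψ‖₂ = 1`) with `w m₀`-energies asymptotically `≤ S - 2δ`,
  contradicting `q̄_{w m₀}[Ψ] ≤ liminf` (`closedEnergy_le_liminf`) and `S ≤ q̄_{w m₀}[Ψ] + δ`.
* Parallelogram law (`LincombGS.rawEnergy_add_sub`): `Q(Φₘ + Φₘ') + Q(Φₘ - Φₘ') = 2Q(Φₘ) + 2Q(Φₘ')
  ≤ 4S + 4δ ≤ Q(Φₘ + Φₘ') + 12δ`, so `∫|∇(Φₘ - Φₘ')|² ≤ Q(Φₘ - Φₘ') ≤ 12δ < ε` for `δ = ε/16`.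
-/

noncomputable section

open MeasureTheory Filter
open scoped ENNReal NNReal Topology

namespace Summit.AtomisticToContinuum.BoseEinsteinCondensation.Theorems.GroundStateRigidity

open Literature.MathematicalPhysics.QuantumManyBody.BoseGas

namespace KineticCauchy

variable {N : ℕ}

/-- The raw quadratic form is monotone in the pair profile: `w ≤ v ⇒ Q_w(f) ≤ Q_v(f)`.
[folklore] -/
theorem rawForm_mono_pot {v w : ℝ → ℝ≥0∞} (h : ∀ r, w r ≤ v r) (f : Config N → ℂ) :
    ∫⁻ X, kineticDensity f X + interaction w X * (‖f X‖₊ : ℝ≥0∞) ^ 2 ≤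
      ∫⁻ X, kineticDensity f X + interaction v X * (‖f X‖₊ : ℝ≥0∞) ^ 2 :=
  lintegral_mono fun X =>
    add_le_add le_rfl (mul_le_mul' (ClosedJensen.interaction_mono h X) le_rfl)

/-- The kinetic energy is at most the raw quadratic form (drop the interaction). [folklore] -/
theorem kinetic_le_rawForm (v : ℝ → ℝ≥0∞) (f : Config N → ℂ) :
    ∫⁻ X, kineticDensity f X ≤
      ∫⁻ X, kineticDensity f X + interaction v X * (‖f X‖₊ : ℝ≥0∞) ^ 2 :=
  lintegral_mono fun _ => le_self_add

/-- **Cancellation in the parallelogram law** (pure `ℝ≥0∞` arithmetic): if `A + D ≤ 4S + 4δ`,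
`4S ≤ A + 8δ` and `A < ⊤`, then `D ≤ 12δ`. [folklore] -/
theorem le_of_parallelogram {A D S δ : ℝ≥0∞} (hA : A ≠ ⊤) (h1 : A + D ≤ 4 * S + 4 * δ)
    (h2 : 4 * S ≤ A + 8 * δ) : D ≤ 12 * δ := by
  refine ENNReal.le_of_add_le_add_left hA (h1.trans ?_)
  calc 4 * S + 4 * δ ≤ A + 8 * δ + 4 * δ := add_le_add h2 le_rfl
    _ = A + 12 * δ := by ring

/-- **Lower bound on sums of approximants from the closed energy.** If `Φₙ → Ψ` in `L²`
(`Ψ` measurable), `a k, b k → ∞`, and the raw `v`-form of the sums `(Φ (a k)).ψ + (Φ (b k)).ψ` is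
at most `4B` for every `k`, then `q̄_v[Ψ] ≤ B`: the midpoints `Gₖ = ((Φ (a k)).ψ + (Φ (b k)).ψ)/2`
are `C¹`, Dirichlet, symmetric, converge to `Ψ` in `L²` with `‖Gₖ‖₂ → ‖Ψ‖₂ = 1`, have raw form
`Q(Gₖ) ≤ B` (scaling), so the normalised midpoints are trial states converging to `Ψ` with energies
`≤ ‖Gₖ‖₂⁻² B → B`, and `closedEnergy_le_liminf` applies. [cite: Kato1966, VI §1.3 Thm 1.16] -/
theorem closedEnergy_le_of_sums (v : ℝ → ℝ≥0∞) {L : ℝ} {Φ : ℕ → TrialState N L}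
    {Ψ : Config N → ℂ} (hΨ : Measurable Ψ) (hΦΨ : TendstoL2 Φ Ψ) {a b : ℕ → ℕ}
    (ha : Tendsto a atTop atTop) (hb : Tendsto b atTop atTop) {B : ℝ≥0∞}
    (hB : ∀ k, ∫⁻ X, kineticDensity (fun Y => (Φ (a k)).ψ Y + (Φ (b k)).ψ Y) X +
        interaction v X * (‖(Φ (a k)).ψ X + (Φ (b k)).ψ X‖₊ : ℝ≥0∞) ^ 2 ≤ 4 * B) :
    closedEnergy v L Ψ ≤ B := by
  -- the midpoints `Gₖ = c (Φ_{a k} + Φ_{b k})`, `c = 1/2`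
  set c : ℝ := 2⁻¹ with hc_def
  set G : ℕ → Config N → ℂ := fun k X => (c : ℂ) * ((Φ (a k)).ψ X + (Φ (b k)).ψ X) with hG_def
  have hsumc : ∀ k, ContDiff ℝ 1 fun X => (Φ (a k)).ψ X + (Φ (b k)).ψ X := fun k =>
    (Φ (a k)).contDiff.add (Φ (b k)).contDiff
  have hGc : ∀ k, ContDiff ℝ 1 (G k) := fun k => contDiff_const.mul (hsumc k)
  have hG0 : ∀ k X, X ∉ boxN N L → G k X = 0 := fun k X hX => by
    simp [hG_def, (Φ (a k)).eq_zero X hX, (Φ (b k)).eq_zero X hX]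
  have hGσ : ∀ k (σ : Equiv.Perm (Fin N)) (X : Config N), G k (X ∘ σ) = G k X :=
    fun k σ X => by simp only [hG_def, (Φ (a k)).symm σ X, (Φ (b k)).symm σ X]
  have hΨ1 : ∫⁻ X, (‖Ψ X‖₊ : ℝ≥0∞) ^ 2 = 1 :=
    hΦΨ.lintegral_nnnorm_sq_eq_one hΨ.aestronglyMeasurable
  -- `Gₖ → Ψ` in `L²`
  have hGF : Tendsto (fun k => ∫⁻ X, (‖G k X - Ψ X‖₊ : ℝ≥0∞) ^ 2) atTop (𝓝 0) := by
    have htol : Tendsto (fun k => (∫⁻ X, (‖(Φ (a k)).ψ X - Ψ X‖₊ : ℝ≥0∞) ^ 2) +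
        ∫⁻ X, (‖(Φ (b k)).ψ X - Ψ X‖₊ : ℝ≥0∞) ^ 2) atTop (𝓝 0) := by
      have h := (hΦΨ.comp ha).add (hΦΨ.comp hb)
      rw [add_zero] at h
      exact h
    have h := LincombGS.tendsto_lincomb (ψ := fun k => (Φ (a k)).ψ) (φ := fun k => (Φ (b k)).ψ)
      (fun k => (Φ (a k)).contDiff.continuous.measurable) hΨ htol (fun k => le_self_add)
      (fun k => le_add_self) (c : ℂ) (c : ℂ)
    refine h.congr fun k => lintegral_congr fun X => ?_
    have e : (c : ℂ) * (Φ (a k)).ψ X + (c : ℂ) * (Φ (b k)).ψ X - ((c : ℂ) * Ψ X + (c : ℂ) * Ψ X) =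
        G k X - Ψ X := by
      simp only [hG_def, hc_def]
      push_cast
      ring
    rw [e]
  -- masses `‖Gₖ‖₂² → 1`
  have hm : Tendsto (fun k => ∫⁻ X, (‖G k X‖₊ : ℝ≥0∞) ^ 2) atTop (𝓝 1) :=
    ExistsNonneg.tendsto_lintegral_nnnorm_sq (G := G)
      (fun k => (hGc k).continuous.aestronglyMeasurable) hΨ.aestronglyMeasurable hΨ1 hGF
  -- raw forms `Q(Gₖ) = Q(Φ_{a k} + Φ_{b k})/4 ≤ B`
  have hc2 : (‖(c : ℂ)‖₊ : ℝ≥0∞) ^ 2 = 4⁻¹ := by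
    rw [ExistsNonneg.coe_nnnorm_ofReal_sq, hc_def, inv_pow,
      ENNReal.ofReal_inv_of_pos (by norm_num)]
    norm_num
  have hQG : ∀ k, ∫⁻ X, kineticDensity (G k) X + interaction v X * (‖G k X‖₊ : ℝ≥0∞) ^ 2 ≤ B := by
    intro k
    have h := LincombGS.rawEnergy_const_mul v (c : ℂ) ((hsumc k).differentiable one_ne_zero)
    simp only [hG_def]
    rw [h, hc2]
    calc 4⁻¹ * _ ≤ 4⁻¹ * (4 * B) := mul_le_mul' le_rfl (hB k)
      _ = B := by rw [← mul_assoc, ENNReal.inv_mul_cancel (by norm_num) (by norm_num), one_mul]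
  -- the normalised midpoints (junk where the mass vanishes, finitely often)
  choose Θ hΘ _hlow using fun k =>
    LincombGS.exists_trialState_normalize (Φ 0) v (hGc k) (hG0 k) (hGσ k)
  have hev : ∀ᶠ k in atTop, ∫⁻ X, (‖G k X‖₊ : ℝ≥0∞) ^ 2 ≠ 0 := hm.eventually_ne one_ne_zero
  -- `Θₖ → Ψ` in `L²`: the normalising constants tend to `1`
  have hΘΨ : TendstoL2 Θ Ψ := by
    have hcst : Tendsto (fun k => Real.sqrt ((∫⁻ X, (‖G k X‖₊ : ℝ≥0∞) ^ 2).toReal)⁻¹) atTop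
        (𝓝 1) := by
      have h1' := (ENNReal.tendsto_toReal ENNReal.one_ne_top).comp hm
      rw [ENNReal.toReal_one] at h1'
      have h2' := (Real.continuous_sqrt.tendsto _).comp (h1'.inv₀ one_ne_zero)
      rwa [inv_one, Real.sqrt_one] at h2'
    refine (ExistsNonneg.tendsto_lintegral_const_mul_sub (G := G) hΨ hΨ1 hcst hGF).congr'
      (hev.mono fun k hk => ?_)
    beta_reduce
    rw [(hΘ k hk).1]
  -- energies `≤ ‖Gₖ‖₂⁻² B → B`
  have hEΘ : ∀ᶠ k in atTop, energy v (Θ k) ≤ (∫⁻ X, (‖G k X‖₊ : ℝ≥0∞) ^ 2)⁻¹ * B :=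
    hev.mono fun k hk => by
      rw [(hΘ k hk).2]
      exact mul_le_mul' le_rfl (hQG k)
  have hlim : Tendsto (fun k => (∫⁻ X, (‖G k X‖₊ : ℝ≥0∞) ^ 2)⁻¹ * B) atTop (𝓝 B) := by
    have h := hm.inv
    rw [inv_one] at h
    have h' := ENNReal.Tendsto.mul_const h (Or.inl one_ne_zero) (b := B)
    rwa [one_mul] at h'
  exact (closedEnergy_le_liminf v hΘΨ).trans ((liminf_le_liminf hEΘ).trans hlim.liminf_eq.le)

end KineticCauchy

open KineticCauchy LincombGS in
/-- **Stub 15c — near-optimal approximants of a measurable `Ψ` for an INCREASING family of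
potentials are Cauchy in kinetic energy.** If trial states `Φₘ → Ψ` in `L²` (`Ψ` measurable),
`energy (w m) (Φ m) ≤ S + o(1)` with `w m ↑` in `m`, and the closed energies `q̄_{w m}[Ψ] ↑ S < ⊤`
(`∀ δ, ∃ m₀, S ≤ q̄_{w m₀}[Ψ] + δ`), then `∫|∇(Φₘ − Φₘ')|² → 0` as `m, m' → ∞`: parallelogram
law for the raw quadratic form of `w m₀` on the `C¹` core (`LincombGS.rawEnergy_add_sub`),
`Q_{m₀}(Φₘ) ≤ energy (w m) (Φ m) ≤ S + o(1)` for `m ≥ m₀`, and the lower bound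
`4 S ≤ Q_{m₀}(Φₘ + Φₘ') + 8δ` for all large `m, m'` (otherwise the normalised midpoints along a
sequence of violating pairs are trial states converging to `Ψ` with `w m₀`-energies eventually
`≤ (1 + o(1))(S − 2δ)`, against `closedEnergy_le_liminf` and `S ≤ q̄_{w m₀}[Ψ] + δ`; `‖Ψ‖₂ = 1` by
`TendstoL2.lintegral_nnnorm_sq_eq_one`), whence `Q_{m₀}(Φₘ − Φₘ') ≤ 12δ < ε` for `δ = ε/16`.
[cite: Kato1966, VI §1.3 Thm 1.16] -/
theorem stub_kineticCauchy :
    ∀ (N : ℕ) (L : ℝ) (w : ℕ → ℝ → ℝ≥0∞) (Φ : ℕ → TrialState N L) (Ψ : Config N → ℂ) (S : ℝ≥0∞),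
      (∀ m : ℕ, Measurable (w m)) → (∀ m m' : ℕ, m ≤ m' → ∀ r : ℝ, w m r ≤ w m' r) → S ≠ ⊤ →
      Measurable Ψ → TendstoL2 Φ Ψ →
      (∀ δ : ℝ≥0∞, 0 < δ → ∀ᶠ m : ℕ in atTop, energy (w m) (Φ m) ≤ S + δ) →
      (∀ δ : ℝ≥0∞, 0 < δ → ∃ m₀ : ℕ, S ≤ closedEnergy (w m₀) L Ψ + δ) →
      ∀ ε : ℝ≥0∞, 0 < ε → ∃ M : ℕ, ∀ m m' : ℕ, M ≤ m → M ≤ m' →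
        ∫⁻ X, kineticDensity (fun Y => (Φ m).ψ Y - (Φ m').ψ Y) X ≤ ε := by
  intro N L w Φ Ψ S _hw hmono hS hΨ hΦΨ hE hC ε hε
  -- the case `ε = ⊤` is trivial
  rcases eq_or_ne ε ⊤ with hεt | hεt
  · exact ⟨0, fun m m' _ _ => hεt ▸ le_top⟩
  -- `δ = ε / 16`
  set δ : ℝ≥0∞ := ε / 16 with hδ_def
  have hδ : 0 < δ := ENNReal.div_pos hε.ne' (by norm_num)
  have h16 : 16 * δ = ε := ENNReal.mul_div_cancel (by norm_num) (by norm_num)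
  obtain ⟨m₀, hm₀⟩ := hC δ hδ
  -- upper bound: `Q_{m₀}(Φ m) ≤ S + δ` for large `m`
  obtain ⟨M₁, hM₁⟩ : ∃ M₁ : ℕ, ∀ m, M₁ ≤ m →
      ∫⁻ X, kineticDensity (Φ m).ψ X + interaction (w m₀) X * (‖(Φ m).ψ X‖₊ : ℝ≥0∞) ^ 2 ≤
        S + δ := by
    obtain ⟨M, hM⟩ := eventually_atTop.1 (hE δ hδ)
    refine ⟨max M m₀, fun m hm => ?_⟩
    exact (rawForm_mono_pot (hmono m₀ m (le_of_max_le_right hm)) (Φ m).ψ).trans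
      (hM m (le_of_max_le_left hm))
  -- lower bound on sums: `4 S ≤ Q_{m₀}(Φ m + Φ m') + 8 δ` for large `m, m'`
  obtain ⟨M₂, hM₂⟩ : ∃ M₂ : ℕ, ∀ m m', M₂ ≤ m → M₂ ≤ m' →
      4 * S ≤ (∫⁻ X, kineticDensity (fun Y => (Φ m).ψ Y + (Φ m').ψ Y) X +
        interaction (w m₀) X * (‖(Φ m).ψ X + (Φ m').ψ X‖₊ : ℝ≥0∞) ^ 2) + 8 * δ := by
    by_cases hSδ : S ≤ 2 * δ
    · refine ⟨0, fun m m' _ _ => ?_⟩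
      calc 4 * S ≤ 4 * (2 * δ) := mul_le_mul' le_rfl hSδ
        _ = 8 * δ := by ring
        _ ≤ _ := le_add_self
    push Not at hSδ
    by_contra hcon
    push Not at hcon
    choose a b ha hb hlt using hcon
    have haT : Tendsto a atTop atTop := tendsto_atTop_mono ha tendsto_id
    have hbT : Tendsto b atTop atTop := tendsto_atTop_mono hb tendsto_id
    have h8t : 8 * δ ≠ ⊤ := ENNReal.mul_ne_top (by norm_num) (ENNReal.div_ne_top hεt (by norm_num))
    have hB : ∀ k, ∫⁻ X, kineticDensity (fun Y => (Φ (a k)).ψ Y + (Φ (b k)).ψ Y) X +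
        interaction (w m₀) X * (‖(Φ (a k)).ψ X + (Φ (b k)).ψ X‖₊ : ℝ≥0∞) ^ 2 ≤
          4 * (S - 2 * δ) := fun k => by
      rw [ENNReal.mul_sub fun _ _ => by norm_num]
      have e : (4 : ℝ≥0∞) * (2 * δ) = 8 * δ := by ring
      rw [e]
      exact ENNReal.le_sub_of_add_le_right h8t (hlt k).le
    have hcl := closedEnergy_le_of_sums (w m₀) hΨ hΦΨ haT hbT hB
    have key : S + δ ≤ S + 0 :=
      calc S + δ ≤ closedEnergy (w m₀) L Ψ + δ + δ := add_le_add hm₀ le_rfl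
        _ ≤ (S - 2 * δ) + δ + δ := by gcongr
        _ = (S - 2 * δ) + 2 * δ := by rw [two_mul, add_assoc]
        _ = S := tsub_add_cancel_of_le hSδ.le
        _ = S + 0 := (add_zero S).symm
    exact hδ.ne' (le_zero_iff.1 (ENNReal.le_of_add_le_add_left hS key))
  -- conclusion from the parallelogram law
  refine ⟨max M₁ M₂, fun m m' hm hm' => ?_⟩
  have hQm := hM₁ m (le_of_max_le_left hm)
  have hQm' := hM₁ m' (le_of_max_le_left hm')
  have hpar := rawEnergy_add_sub (w m₀) (Φ m).contDiff (Φ m').contDiff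
  have hSδt : S + δ ≠ ⊤ := ENNReal.add_ne_top.2 ⟨hS, ENNReal.div_ne_top hεt (by norm_num)⟩
  have h1 : (∫⁻ X, kineticDensity (fun Y => (Φ m).ψ Y + (Φ m').ψ Y) X +
        interaction (w m₀) X * (‖(Φ m).ψ X + (Φ m').ψ X‖₊ : ℝ≥0∞) ^ 2) +
      ∫⁻ X, kineticDensity (fun Y => (Φ m).ψ Y - (Φ m').ψ Y) X +
        interaction (w m₀) X * (‖(Φ m).ψ X - (Φ m').ψ X‖₊ : ℝ≥0∞) ^ 2 ≤ 4 * S + 4 * δ := by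
    rw [hpar]
    calc 2 * _ + 2 * _ ≤ 2 * (S + δ) + 2 * (S + δ) :=
          add_le_add (mul_le_mul' le_rfl hQm) (mul_le_mul' le_rfl hQm')
      _ = 4 * S + 4 * δ := by ring
  have hA : (∫⁻ X, kineticDensity (fun Y => (Φ m).ψ Y + (Φ m').ψ Y) X +
      interaction (w m₀) X * (‖(Φ m).ψ X + (Φ m').ψ X‖₊ : ℝ≥0∞) ^ 2) ≠ ⊤ := by
    refine ne_top_of_le_ne_top ?_ (le_self_add.trans h1)
    have e : (4 : ℝ≥0∞) * S + 4 * δ = 4 * (S + δ) := by ring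
    rw [e]
    exact ENNReal.mul_ne_top (by norm_num) hSδt
  have hD := le_of_parallelogram hA h1 (hM₂ m m' (le_of_max_le_right hm) (le_of_max_le_right hm'))
  calc ∫⁻ X, kineticDensity (fun Y => (Φ m).ψ Y - (Φ m').ψ Y) X
      ≤ ∫⁻ X, kineticDensity (fun Y => (Φ m).ψ Y - (Φ m').ψ Y) X +
          interaction (w m₀) X * (‖(Φ m).ψ X - (Φ m').ψ X‖₊ : ℝ≥0∞) ^ 2 :=
        kinetic_le_rawForm (w m₀) _
    _ ≤ 12 * δ := hD
    _ ≤ 16 * δ := mul_le_mul' (by norm_num) le_rfl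
    _ = ε := h16

end Summit.AtomisticToContinuum.BoseEinsteinCondensation.Theorems.GroundStateRigidity

end
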